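import Literature.MathematicalPhysics.QuantumLattice.InfVolFermionState
import Literature.MathematicalPhysics.QuantumLattice.TranslationInvariantGroundStates
import Literature.Probability.LatticeModels.ZdBoxesLines
import HarnessLib

/-!
# The terms of the Hubbard interaction on `ℤ^d` and its mean-energy observable

Topic `Literature/MathematicalPhysics/QuantumLattice`; namespace
`Literature.MathematicalPhysics.QuantumLattice` (the file path). Companion of
`InfVolFermionState.lean` §6 (`hubbardFermionInteraction`, `FermionInteraction.meanEnergyObs`):
the interaction `Φ` of the Hubbard model, defined there by a case formula over all finite
`X ⊆ ℤ^d`, is evaluated in closed form, and so is its mean-energy observable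
`E_Φ = Σ_{X ∋ 0} Φ(X)/|X|` of range `1`. Everything is PROVED; no definition, no named fact.

## Results

* `hubbardFermionInteraction_apply_singleton`: `Φ {x} = U n_{x↑} n_{x↓}`;
* `hubbardFermionInteraction_apply_pair`:
  `Φ {x, x + e_i} = -t Σ_σ (c†_{xσ} c_{x+e_i,σ} + c†_{x+e_i,σ} c_{xσ})`;
* `hubbardFermionInteraction_apply_eq_zero`: `Φ X = 0` for every other `X`;
* `FermionInteraction.meanEnergyObs_eq_sum`: for ANY interaction, the mean-energy observable as a
  plain sum over the subsets of its region (the `attach` bookkeeping of the definition removed);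
* `hubbardFermionInteraction_meanEnergyObs`: the mean-energy observable of the Hubbard interaction
  at range `1` is `U n_{0↑}n_{0↓} + ½ Σ_i (Φ{0, e_i} + Φ{-e_i, 0})` (embedded in `𝔄_{[-1,1]^d}`):
  the on-site term through the origin plus half of each of the `2d` bonds through the origin.

Hubbard (1963); Lieb, arXiv:cond-mat/9311033 §2 (the Hamiltonian); Bratteli–Kishimoto–Robinson
(1978) §3 and Bratteli–Robinson II §6.2.4 (the mean energy `Σ_{X∋0} Φ(X)/|X|`).

## What is NOT here

The identification of the translates of `E_Φ` on a torus with the torus Hubbard Hamiltonian and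
the energy density of torus-limit states (`InfVolFermionStateHubbardEnergy.lean`).
-/

noncomputable section

namespace Literature.MathematicalPhysics.QuantumLattice

open Matrix Finset HubbardWave0 Literature.Probability.LatticeModels

variable {d : ℕ}

/-! ### Unit vectors of `ℤ^d` (`unitVec i = uvec i = Pi.single i 1`; the basic facts
`uvec_ne_zero`, `uvec_add_uvec_ne_zero`, `uvec_injective` are the tree's) -/

/-- `x ≠ x + e_i`. [folklore] -/
theorem self_ne_add_unitVec (x : Site d) (i : Fin d) : x ≠ x + unitVec i := fun h =>
  uvec_ne_zero i (left_eq_add.1 h)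

/-- `x + e_i + e_j ≠ x`. [folklore] -/
theorem add_unitVec_add_unitVec_ne_self (x : Site d) (i j : Fin d) : x + unitVec i + unitVec j ≠ x := by
  intro h
  rw [add_assoc, add_eq_left] at h
  exact uvec_add_uvec_ne_zero i j h

/-! ### The three cases of the Hubbard interaction -/

section Terms

variable (t U : ℝ)

/-- **On-site term**: `Φ {x} = U n_{x↑} n_{x↓}`. [cite: arXiv9311033, §2 (the Hubbard Hamiltonian)] -/
theorem hubbardFermionInteraction_apply_singleton (x : Site d) :
    (hubbardFermionInteraction d t U).Φ {x} =
      (U : ℂ) • (nAt x (mem_singleton_self x) 0 * nAt x (mem_singleton_self x) 1) := by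
  have hB : ∀ a b : Site d, ¬ ((∃ i : Fin d, b = a + unitVec i) ∧ ({x} : Finset (Site d)) = {a, b}) := by
    rintro a b ⟨⟨i, rfl⟩, h⟩
    have ha : a ∈ ({x} : Finset (Site d)) := h ▸ mem_insert_self _ _
    have hb : a + unitVec i ∈ ({x} : Finset (Site d)) := h ▸ mem_insert_of_mem (mem_singleton_self _)
    rw [mem_singleton] at ha hb
    exact self_ne_add_unitVec a i (ha.trans hb.symm)
  simp only [hubbardFermionInteraction, hB, if_false, sum_const_zero, add_zero]
  rw [Finset.sum_eq_single ⟨x, mem_singleton_self x⟩, if_pos rfl]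
  · rintro ⟨b, hb⟩ - hne
    exact absurd (Subtype.ext (mem_singleton.1 hb)) hne
  · intro h
    exact absurd (mem_attach _ _) h

/-- **Bond term**: `Φ {x, x + e_i} = -t Σ_σ (c†_{xσ} c_{x+e_i,σ} + c†_{x+e_i,σ} c_{xσ})`.
[cite: arXiv9311033, §2 (the Hubbard Hamiltonian)] -/
theorem hubbardFermionInteraction_apply_pair (x : Site d) (i : Fin d) :
    (hubbardFermionInteraction d t U).Φ {x, x + unitVec i} =
      -(t : ℂ) • ∑ σ : Fin 2,
        ((cAt x (mem_insert_self _ _) σ)ᴴ *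
            cAt (x + unitVec i) (mem_insert_of_mem (mem_singleton_self _)) σ +
          (cAt (x + unitVec i) (mem_insert_of_mem (mem_singleton_self _)) σ)ᴴ *
            cAt x (mem_insert_self _ _) σ) := by
  have hxy : x ≠ x + unitVec i := self_ne_add_unitVec x i
  have hcard : ({x, x + unitVec i} : Finset (Site d)).card = 2 := card_pair hxy
  -- the on-site part vanishes on a two-element set
  have hA : ∀ a : Site d, ¬ (({x, x + unitVec i} : Finset (Site d)) = {a}) := fun a h => by
    have := congrArg Finset.card h
    rw [hcard, card_singleton] at this
    exact absurd this (by norm_num)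
  simp only [hubbardFermionInteraction, hA, if_false, sum_const_zero, zero_add]
  -- the bond double sum has exactly one nonzero term, `(a, b) = (x, x + e_i)`
  have hmem : ∀ {a : Site d}, a ∈ ({x, x + unitVec i} : Finset (Site d)) ↔ a = x ∨ a = x + unitVec i :=
    fun {a} => by rw [mem_insert, mem_singleton]
  rw [Finset.sum_eq_single ⟨x, mem_insert_self _ _⟩]
  · rw [Finset.sum_eq_single ⟨x + unitVec i, mem_insert_of_mem (mem_singleton_self _)⟩, if_pos ⟨⟨i, rfl⟩, rfl⟩]
    · rintro ⟨b, hb⟩ - hne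
      refine if_neg ?_
      rintro ⟨⟨j, hj⟩, -⟩
      rcases hmem.1 hb with rfl | rfl
      · exact self_ne_add_unitVec _ j hj
      · exact hne rfl
    · intro h
      exact absurd (mem_attach _ _) h
  · rintro ⟨a, ha⟩ - hne
    refine Finset.sum_eq_zero fun b _ => if_neg ?_
    rintro ⟨⟨j, hj⟩, -⟩
    rcases hmem.1 ha with rfl | rfl
    · exact hne rfl
    · rcases hmem.1 b.2 with hb | hb
      · exact add_unitVec_add_unitVec_ne_self _ i j (hj.symm.trans hb)
      · exact self_ne_add_unitVec _ j (hb.symm.trans hj)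
  · intro h
    exact absurd (mem_attach _ _) h

/-- **All other terms vanish**: if `X` is neither a singleton nor a nearest-neighbour pair
`{x, x + e_i}`, then `Φ X = 0`. [cite: arXiv9311033, §2 (the Hubbard Hamiltonian)] -/
theorem hubbardFermionInteraction_apply_eq_zero {X : Finset (Site d)} (h1 : ∀ x : Site d, X ≠ {x})
    (h2 : ∀ (x : Site d) (i : Fin d), X ≠ {x, x + unitVec i}) :
    (hubbardFermionInteraction d t U).Φ X = 0 := by
  have hB : ∀ a b : Site d, ¬ ((∃ i : Fin d, b = a + unitVec i) ∧ X = {a, b}) := by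
    rintro a b ⟨⟨i, rfl⟩, h⟩
    exact h2 a i h
  simp only [hubbardFermionInteraction, h1, hB, if_false, sum_const_zero, add_zero]

end Terms

/-! ### The mean-energy observable of the Hubbard interaction -/

section MeanEnergy

variable (t U : ℝ)

/-- The mean-energy observable as a plain sum over subsets (the `attach` of the definition
removed): `E_Φ = Σ_{X ⊆ Λ_R, 0 ∈ X} |X|⁻¹ Γ(X ⊆ Λ_R)(Φ X)`, the embedding chosen through
`dite`. [folklore] -/
theorem FermionInteraction.meanEnergyObs_eq_sum (Ψ : FermionInteraction d) (R : ℝ) :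
    Ψ.meanEnergyObs R =
      ∑ X ∈ (thicken ({0} : Finset (Site d)) R).powerset with (0 : Site d) ∈ X,
        if h : X ⊆ thicken ({0} : Finset (Site d)) R then
          ((X.card : ℂ)⁻¹) • fermionEmbed (PolySite.incl h) (Ψ.Φ X) else 0 := by
  rw [FermionInteraction.meanEnergyObs, Finset.sum_filter, Finset.sum_filter,
    ← Finset.sum_attach ((thicken ({0} : Finset (Site d)) R).powerset)]
  refine Finset.sum_congr rfl fun X _ => ?_
  by_cases h0 : (0 : Site d) ∈ X.1
  · rw [if_pos h0, if_pos h0, dif_pos (Finset.mem_powerset.1 X.2)]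
  · rw [if_neg h0, if_neg h0]

/-- `e_i ∈ [-1,1]^d = thicken {0} 1`. [folklore] -/
theorem unitVec_mem_thicken_one (i : Fin d) : (unitVec i : Site d) ∈ thicken ({0} : Finset (Site d)) 1 := by
  rw [thicken, Finset.singleton_biUnion, Nat.floor_one]
  refine mem_image.2 ⟨unitVec i, ?_, zero_add _⟩
  rw [mem_box]
  intro j
  by_cases hj : j = i
  · subst hj; simp
  · simp [Pi.single_eq_of_ne hj]

/-- `-e_i ∈ [-1,1]^d = thicken {0} 1`. [folklore] -/
theorem neg_unitVec_mem_thicken_one (i : Fin d) : (-unitVec i : Site d) ∈ thicken ({0} : Finset (Site d)) 1 := by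
  rw [thicken, Finset.singleton_biUnion, Nat.floor_one]
  refine mem_image.2 ⟨-unitVec i, ?_, zero_add _⟩
  rw [mem_box]
  intro j
  by_cases hj : j = i
  · subst hj; simp
  · simp [Pi.single_eq_of_ne hj]

/-- `{0, e_i} ⊆ thicken {0} 1`. [folklore] -/
theorem pair_unitVec_subset_thicken_one (i : Fin d) :
    ({0, 0 + unitVec i} : Finset (Site d)) ⊆ thicken ({0} : Finset (Site d)) 1 := by
  rw [zero_add]
  exact insert_subset (zero_mem_thicken_zero 1) (singleton_subset_iff.2 (unitVec_mem_thicken_one i))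

/-- `{-e_i, 0} ⊆ thicken {0} 1`. [folklore] -/
theorem pair_neg_unitVec_subset_thicken_one (i : Fin d) :
    ({-unitVec i, -unitVec i + unitVec i} : Finset (Site d)) ⊆ thicken ({0} : Finset (Site d)) 1 := by
  rw [neg_add_cancel]
  exact insert_subset (neg_unitVec_mem_thicken_one i) (singleton_subset_iff.2 (zero_mem_thicken_zero 1))

/-- **The mean-energy observable of the Hubbard interaction** (range `1`): in `𝔄_{[-1,1]^d}`,
`E_Φ = Γ(Φ{0}) + Σ_i (½ Γ(Φ{0, e_i}) + ½ Γ(Φ{-e_i, 0}))`, i.e. the on-site repulsion at the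
origin plus one half of each of the `2d` hopping bonds through the origin (all other `X ∋ 0` carry
`Φ X = 0`). Bratteli–Robinson II §6.2.4; Bratteli–Kishimoto–Robinson (1978) §3.
[cite: BratteliKishimotoRobinson1978, §3 (mean energy functional)] -/
theorem hubbardFermionInteraction_meanEnergyObs :
    (hubbardFermionInteraction d t U).meanEnergyObs 1 =
      fermionEmbed (PolySite.incl (singleton_subset_iff.2 (zero_mem_thicken_zero 1)))
          ((hubbardFermionInteraction d t U).Φ {0}) +
        ∑ i : Fin d,
          ((2 : ℂ)⁻¹ • fermionEmbed (PolySite.incl (pair_unitVec_subset_thicken_one i))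
              ((hubbardFermionInteraction d t U).Φ {0, 0 + unitVec i}) +
            (2 : ℂ)⁻¹ • fermionEmbed (PolySite.incl (pair_neg_unitVec_subset_thicken_one i))
              ((hubbardFermionInteraction d t U).Φ {-unitVec i, -unitVec i + unitVec i})) := by
  classical
  set T : Finset (Site d) := thicken ({0} : Finset (Site d)) 1 with hT
  set F : Finset (Site d) → FermionOp T := fun X =>
    if h : X ⊆ T then ((X.card : ℂ)⁻¹) • fermionEmbed (PolySite.incl h) ((hubbardFermionInteraction d t U).Φ X)
    else 0 with hF
  rw [FermionInteraction.meanEnergyObs_eq_sum]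
  change ∑ X ∈ T.powerset with (0 : Site d) ∈ X, F X = _
  -- the support: `{0}`, `{0, e_i}`, `{-e_i, 0}`
  set S' : Finset (Finset (Site d)) :=
    insert {0} ((univ.image fun i : Fin d => ({0, 0 + unitVec i} : Finset (Site d))) ∪
      univ.image fun i : Fin d => ({-unitVec i, -unitVec i + unitVec i} : Finset (Site d))) with hS'
  have hS'sub : S' ⊆ T.powerset.filter fun X => (0 : Site d) ∈ X := by
    intro X hX
    rw [hS', mem_insert, mem_union, mem_image, mem_image] at hX
    rw [mem_filter, mem_powerset]
    rcases hX with rfl | ⟨i, -, rfl⟩ | ⟨i, -, rfl⟩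
    · exact ⟨singleton_subset_iff.2 (zero_mem_thicken_zero 1), mem_singleton_self _⟩
    · exact ⟨pair_unitVec_subset_thicken_one i, mem_insert_self _ _⟩
    · refine ⟨pair_neg_unitVec_subset_thicken_one i, ?_⟩
      rw [neg_add_cancel]
      exact mem_insert_of_mem (mem_singleton_self _)
  have hzero : ∀ X ∈ T.powerset.filter (fun X => (0 : Site d) ∈ X), X ∉ S' → F X = 0 := by
    intro X hX hXS
    rw [mem_filter, mem_powerset] at hX
    have hΦ : (hubbardFermionInteraction d t U).Φ X = 0 := by
      refine hubbardFermionInteraction_apply_eq_zero t U (fun x hx => hXS ?_) (fun x i hx => hXS ?_)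
      · have : x = 0 := by
          have h0 := hX.2; rw [hx, mem_singleton] at h0; exact h0.symm
        subst this
        rw [hS', hx]
        exact mem_insert_self _ _
      · have h0 := hX.2
        rw [hx, mem_insert, mem_singleton] at h0
        rw [hS', hx, mem_insert, mem_union, mem_image, mem_image]
        rcases h0 with h0 | h0
        · exact Or.inr (Or.inl ⟨i, mem_univ _, by rw [← h0, zero_add]⟩)
        · refine Or.inr (Or.inr ⟨i, mem_univ _, ?_⟩)
          have : x = -unitVec i := eq_neg_of_add_eq_zero_left h0.symm
          rw [this]
    simp only [hF, hΦ, map_zero, smul_zero, dite_eq_ite, ite_self]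
  rw [← Finset.sum_subset hS'sub hzero]
  -- split the sum over `S'`
  have hnot0 : ({0} : Finset (Site d)) ∉
      (univ.image fun i : Fin d => ({0, 0 + unitVec i} : Finset (Site d))) ∪
        univ.image fun i : Fin d => ({-unitVec i, -unitVec i + unitVec i} : Finset (Site d)) := by
    rw [mem_union, mem_image, mem_image]
    rintro (⟨i, -, h⟩ | ⟨i, -, h⟩)
    · have := congrArg Finset.card h
      rw [card_pair (self_ne_add_unitVec 0 i), card_singleton] at this
      exact absurd this (by norm_num)
    · have := congrArg Finset.card h
      rw [card_pair (self_ne_add_unitVec _ i), card_singleton] at this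
      exact absurd this (by norm_num)
  have hdisj : Disjoint (univ.image fun i : Fin d => ({0, 0 + unitVec i} : Finset (Site d)))
      (univ.image fun i : Fin d => ({-unitVec i, -unitVec i + unitVec i} : Finset (Site d))) := by
    rw [disjoint_iff_ne]
    rintro X hX Y hY rfl
    rw [mem_image] at hX hY
    obtain ⟨i, -, rfl⟩ := hX
    obtain ⟨j, -, hj⟩ := hY
    have hmem : -unitVec j ∈ ({0, 0 + unitVec i} : Finset (Site d)) := hj ▸ mem_insert_self _ _
    rw [mem_insert, mem_singleton, zero_add, neg_eq_zero] at hmem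
    rcases hmem with h | h
    · exact uvec_ne_zero j h
    · exact uvec_add_uvec_ne_zero j i (show unitVec j + unitVec i = 0 by rw [← h, add_neg_cancel])
  have hinj1 : Set.InjOn (fun i : Fin d => ({0, 0 + unitVec i} : Finset (Site d))) ↑(univ : Finset (Fin d)) := by
    intro i _ j _ h
    dsimp only at h
    have hmem : 0 + unitVec i ∈ ({0, 0 + unitVec j} : Finset (Site d)) := h ▸ mem_insert_of_mem (mem_singleton_self _)
    rw [mem_insert, mem_singleton, zero_add, zero_add] at hmem
    rcases hmem with h' | h'
    · exact absurd h' (uvec_ne_zero i)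
    · exact uvec_injective h'
  have hinj2 : Set.InjOn (fun i : Fin d => ({-unitVec i, -unitVec i + unitVec i} : Finset (Site d)))
      ↑(univ : Finset (Fin d)) := by
    intro i _ j _ h
    dsimp only at h
    have hmem : -unitVec i ∈ ({-unitVec j, -unitVec j + unitVec j} : Finset (Site d)) := by
      have : -unitVec i ∈ ({-unitVec i, -unitVec i + unitVec i} : Finset (Site d)) := mem_insert_self _ _
      rwa [h] at this
    rw [mem_insert, mem_singleton, neg_add_cancel, neg_inj, neg_eq_zero] at hmem
    rcases hmem with h' | h'
    · exact uvec_injective h'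
    · exact absurd h' (uvec_ne_zero i)
  rw [hS', Finset.sum_insert hnot0, Finset.sum_union hdisj, Finset.sum_image hinj1, Finset.sum_image hinj2,
    ← Finset.sum_add_distrib]
  -- evaluate `F` on the three kinds of sets
  have h0T : ({0} : Finset (Site d)) ⊆ T := singleton_subset_iff.2 (zero_mem_thicken_zero 1)
  have h1T : ∀ i : Fin d, ({0, 0 + unitVec i} : Finset (Site d)) ⊆ T := fun i =>
    pair_unitVec_subset_thicken_one i
  have h2T : ∀ i : Fin d, ({-unitVec i, -unitVec i + unitVec i} : Finset (Site d)) ⊆ T := fun i =>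
    pair_neg_unitVec_subset_thicken_one i
  have hF0 : F {0} = fermionEmbed (PolySite.incl h0T) ((hubbardFermionInteraction d t U).Φ {0}) := by
    simp only [hF]
    rw [dif_pos h0T, card_singleton, Nat.cast_one, inv_one, one_smul]
  have hF1 : ∀ i : Fin d, F {0, 0 + unitVec i} =
      (2 : ℂ)⁻¹ • fermionEmbed (PolySite.incl (h1T i)) ((hubbardFermionInteraction d t U).Φ {0, 0 + unitVec i}) := by
    intro i
    simp only [hF]
    rw [dif_pos (h1T i), card_pair (self_ne_add_unitVec (0 : Site d) i), Nat.cast_ofNat]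
  have hF2 : ∀ i : Fin d, F {-unitVec i, -unitVec i + unitVec i} =
      (2 : ℂ)⁻¹ • fermionEmbed (PolySite.incl (h2T i))
        ((hubbardFermionInteraction d t U).Φ {-unitVec i, -unitVec i + unitVec i}) := by
    intro i
    simp only [hF]
    rw [dif_pos (h2T i), card_pair (self_ne_add_unitVec (-unitVec i : Site d) i), Nat.cast_ofNat]
  rw [hF0]
  exact congrArg _ (Finset.sum_congr rfl fun i _ => by rw [hF1, hF2])

end MeanEnergy

end Literature.MathematicalPhysics.QuantumLattice

end
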